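import Mathlib

/-!
# SoloBlind — the exact `c₁` cross-check (LEMMA DICT6, LEMMA CG, THEOREM C1X, COR NINE)

Elementary, kernel-checkable identities behind the soloist note `work/s96/c1-crosscheck.md`
(HodgeConjecture solo-blind residency, session s96).  Setting (not formalised): `C₆` is the
Fermat sextic curve `u₀⁶+u₁⁶+u₂⁶ = 0`, `X₀` the Fermat sextic fourfold, `e_a` the raw residue
classes `Res[u^{a-1}Ω/F^{|a|}]`, `φ` the crystalline Frobenius at `p = 5`, `Γ := Γ₅(1/3)`.
THEOREM C1X says that the fourfold Frobenius constant `c₁` (`φe₁ = c₁e₃` on the `A`-invariant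
primitive cohomology) equals `5·c_{2→4}²` where `φe₂₂₂ = c_{2→4}e₄₄₄` on the curve, hence
`c₁ = 125Γ⁶` — from Coleman's curve constants (cited, Kedlaya-checked), the join-period ratio
`κ'/κ = B(1,1)/B(2,2) = 6` (COR STAR of the residency) and an explicit dictionary on `C₆`.
None of the cohomology is formalised.  What is checked here:

* `affine_reduction_333`, `reduction_factor` : the affine pole reduction
  `g ds∧dt/f² = -d((P ds + Q dt)/f) + (1 - (p+q+2)/6)·g ds∧dt/f` for `g = s³t³`,
  `f = s⁶+t⁶+1`, `P = s³t⁴/6`, `Q = -s⁴t³/6`, written out as a polynomial identity with the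
  hand-supplied partial derivatives `∂ₛQ = -(4/6)s³t³`, `∂ₜP = (4/6)s³t³`, `∂ₛf = 6s⁵`,
  `∂ₜf = 6t⁵` (coefficient of `ds∧dt` in `d((P ds+Q dt)/f)` is `(∂ₛQ-∂ₜP)/f-(Q∂ₛf-P∂ₜf)/f²`),
  and the general factor `1-((m-a₀-1)+(m-a₁-1)+2)/m = -a₂/m` when `a₀+a₁+a₂ = m`;
* `pullback_coefficients`, `twist_coefficients` : the `ds`-coefficients of the pulled-back
  forms under `(x,y) = (-s²,-t²)` (`dx = -2s ds`) and under Coleman's twist `x = i s`, `y = i t`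
  (`i² = -1`): `dx/y² ↦ 12·e₂₂₂`, `x dx/y ↦ -36·e₄₄₄`, `ω_{6,2,2} ↦ 6e₂₂₂`, `ω_{6,4,4} ↦ -18e₄₄₄`
  with `e₂₂₂ = -s ds/(6t⁴)`, `e₄₄₄ ≡ s³ ds/(18t²)`;
* `weierstrass_defect`, `weierstrass_on_curve`, `holomorphic_form_dictionary`,
  `second_kind_dictionary` : the Fermat-cubic dictionary `x³+y³ = 1 → Y² = X³-432`,
  `X = 12/(x+y)`, `Y = 36(x-y)/(x+y)`: `dx/y² = 3dX/Y` and
  `x dx/y = -(1/4)X dX/Y + d(x-y)` modulo the curve equation (note `Y/(3X) = x-y`), as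
  rational-function identities with the defect term `(x³+y³-1)` explicit;
* `frobenius_transport` : linear-algebra transport of `φω₁₁ = aω₂₂`, `φω₂₂ = bω₁₁` to
  `e₂₂₂ = ω₁₁/12`, `e₄₄₄ = -ω₂₂/36`: `c_{2→4} = -3a`, `c_{4→2} = -b/3`; with Coleman's
  `a = -(5/3)Γ³`, `b = 3Γ⁻³`: `c_{2→4} = 5Γ³`, `c_{4→2} = -Γ⁻³` (`raw_constants`);
* `c1_from_FJ_and_STAR` : the assembly — from the (denominator-cleared) FJ relation
  `6c₁·κ·c_{4→2}·Q₄₄₄ = 25·κ'·c_{2→4}·Q₂₂₂`, `Q₄₄₄ = -Q₂₂₂`, `κ' = 6κ` and `c_{2→4}c_{4→2} = -5`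
  it follows that `c₁ = 5c_{2→4}²`; `c1_value` : `5(5Γ³)² = 125Γ⁶`, `625/(125Γ⁶) = 5Γ⁻⁶`;
* `residue_pairing_leading_terms`, `closing_arithmetic` : the leading-term arithmetic of
  LEMMA CG (`⟨e_a,e_ā⟩ = m·(1/m³) = 1/m²`), the Beta values `B(1,1) = 1`, `B(2,2) = 1/6`, the
  dictionary constants `λ = 1/4`, `μ = 1/144`, `λ/μ = 36`, the pairing consistency
  `λμ·4·4 = 1/36 = 6/216`, COR NINE (`(18²/6)/6²·6 = 9`) and the literature shape
  `(-1)^{l+1}5^{4-l}` at `l = 1, 3`.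
-/

namespace Summit.HodgeConjecture.HodgeConjecture.Theorems.C1CrossCheck

/-! ## 1. Affine pole reduction (LEMMA DICT6 (ii)) -/

/-- The reduction of `s³t³ ds∧dt/f²` to pole order one on the affine Fermat sextic curve,
multiplied through by `f²`: `g = -((∂ₛQ-∂ₜP)·f - (Q∂ₛf - P∂ₜf)) + (-1/3)·g·f` with
`g = s³t³`, `f = s⁶+t⁶+1`, `Q = -s⁴t³/6`, `P = s³t⁴/6`, `∂ₛQ = -(4/6)s³t³`, `∂ₜP = (4/6)s³t³`,
`∂ₛf = 6s⁵`, `∂ₜf = 6t⁵` (derivatives supplied by hand). -/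
theorem affine_reduction_333 (s t : ℚ) :
    s ^ 3 * t ^ 3 =
      -(((-(4 * s ^ 3 * t ^ 3) / 6) - 4 * s ^ 3 * t ^ 3 / 6) * (s ^ 6 + t ^ 6 + 1)
          - ((-(s ^ 4 * t ^ 3) / 6) * (6 * s ^ 5) - (s ^ 3 * t ^ 4 / 6) * (6 * t ^ 5)))
        + (-1 / 3 : ℚ) * (s ^ 3 * t ^ 3) * (s ^ 6 + t ^ 6 + 1) := by
  ring

/-- The same reduction for `g = s⁴t⁴` (factor `-2/3`) and `g = s⁴t³` (factor `-1/2`), the two other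
holomorphic character types of `C₆` used in LEMMA CG. -/
theorem affine_reduction_44_43 (s t : ℚ) :
    (s ^ 4 * t ^ 4 =
      -(((-(5 * s ^ 4 * t ^ 4) / 6) - 5 * s ^ 4 * t ^ 4 / 6) * (s ^ 6 + t ^ 6 + 1)
          - ((-(s ^ 5 * t ^ 4) / 6) * (6 * s ^ 5) - (s ^ 4 * t ^ 5 / 6) * (6 * t ^ 5)))
        + (-2 / 3 : ℚ) * (s ^ 4 * t ^ 4) * (s ^ 6 + t ^ 6 + 1)) ∧
    (s ^ 4 * t ^ 3 =
      -(((-(5 * s ^ 4 * t ^ 3) / 6) - 4 * s ^ 4 * t ^ 3 / 6) * (s ^ 6 + t ^ 6 + 1)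
          - ((-(s ^ 5 * t ^ 3) / 6) * (6 * s ^ 5) - (s ^ 4 * t ^ 4 / 6) * (6 * t ^ 5)))
        + (-1 / 2 : ℚ) * (s ^ 4 * t ^ 3) * (s ^ 6 + t ^ 6 + 1)) := by
  constructor <;> ring

/-- The general reduction factor: for the conjugate `ā = (m-a₀, m-a₁, m-a₂)` of a holomorphic
character (`a₀+a₁+a₂ = m`) the affine monomial is `s^{m-a₀-1}t^{m-a₁-1}` and
`1 - ((m-a₀-1)+(m-a₁-1)+2)/m = -a₂/m`. -/
theorem reduction_factor (m a0 a1 a2 : ℚ) (hm : m ≠ 0) (h : a0 + a1 + a2 = m) :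
    1 - ((m - a0 - 1) + (m - a1 - 1) + 2) / m = -a2 / m := by
  rw [show (m - a0 - 1) + (m - a1 - 1) + 2 = m + a2 by linarith]
  field_simp
  ring

/-! ## 2. Pull-backs and Coleman's twist (LEMMA DICT6 (i)–(iii)) -/

/-- `ds`-coefficients under `π : (s,t) ↦ (x,y) = (-s², -t²)`, `dx = -2s ds`:
`dx/y² = -2s ds/t⁴ = 12·(-s ds/(6t⁴)) = 12e₂₂₂` and
`x dx/y = (-s²)(-2s)ds/(-t²) = -36·(s³ds/(18t²)) = -36e₄₄₄`. -/
theorem pullback_coefficients (s t : ℚ) (ht : t ≠ 0) :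
    (-2 * s) / t ^ 4 = 12 * (-s / (6 * t ^ 4)) ∧
    (-s ^ 2) * (-2 * s) / (-t ^ 2) = -36 * (s ^ 3 / (18 * t ^ 2)) := by
  constructor
  · field_simp
    ring
  · field_simp
    ring

/-- Coleman's model `x⁶+y⁶ = 1` is reached from `s⁶+t⁶ = -1` by `x = i s`, `y = i t` with `i² = -1`
(`±i₅` are the sixth roots of `-1` in `ℚ₅`).  The monomial bookkeeping:
`ω_{6,2,2} = x y⁻⁴ dx` has numerator `(is)·i = -s` and denominator `(it)⁴ = t⁴` (so `= 6e₂₂₂`);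
`ω_{6,4,4} = x³y⁻²dx` has numerator `(is)³·i = s³` and denominator `(it)² = -t²` (so `≡ -18e₄₄₄`). -/
theorem twist_coefficients {K : Type*} [CommRing K] (i s t : K) (h : i ^ 2 = -1) :
    (i * s) * i = -s ∧ (i * t) ^ 4 = t ^ 4 ∧ (i * s) ^ 3 * i = s ^ 3 ∧ (i * t) ^ 2 = -t ^ 2 := by
  refine ⟨?_, ?_, ?_, ?_⟩
  · linear_combination s * h
  · linear_combination (t ^ 4 * (i ^ 2 - 1)) * h
  · linear_combination (s ^ 3 * (i ^ 2 - 1)) * h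
  · linear_combination t ^ 2 * h

/-! ## 3. The Fermat-cubic Weierstrass dictionary (re-verification of the s92 dictionary) -/

/-- `Y² - (X³ - 432) = 1728(x³+y³-1)/(x+y)³` for `X = 12/(x+y)`, `Y = 36(x-y)/(x+y)`. -/
theorem weierstrass_defect (x y : ℚ) (hxy : x + y ≠ 0) :
    (36 * (x - y) / (x + y)) ^ 2 - ((12 / (x + y)) ^ 3 - 432) =
      1728 * (x ^ 3 + y ^ 3 - 1) / (x + y) ^ 3 := by
  field_simp
  ring

/-- On the Fermat cubic `x³+y³ = 1`: `Y² = X³ - 432`. -/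
theorem weierstrass_on_curve (x y : ℚ) (hxy : x + y ≠ 0) (h : x ^ 3 + y ^ 3 = 1) :
    (36 * (x - y) / (x + y)) ^ 2 = (12 / (x + y)) ^ 3 - 432 := by
  have h0 := weierstrass_defect x y hxy
  rw [h] at h0
  have : (1728 : ℚ) * (1 - 1) / (x + y) ^ 3 = 0 := by simp
  rw [this] at h0
  exact sub_eq_zero.mp h0

/-- `dx/y² = 3 dX/Y` identically (no curve equation needed), where along the curve
`dX = -12(1 + y')/(x+y)² dx` with `y' = dy/dx = -x²/y²`. -/
theorem holomorphic_form_dictionary (x y : ℚ) (hy : y ≠ 0) (hxy : x + y ≠ 0) (hne : x ≠ y) :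
    1 / y ^ 2 = 3 * ((-12) * (1 - x ^ 2 / y ^ 2) / (x + y) ^ 2) / (36 * (x - y) / (x + y)) := by
  have hmn : x - y ≠ 0 := sub_ne_zero.mpr hne
  field_simp
  ring

/-- `x dx/y = -(1/4)·X dX/Y + d(x - y)` modulo the curve equation: the `dx`-coefficient defect is
`x/y - (-(1/4)·X·X'/Y + (1 + x²/y²)) = -(x³+y³-1)/(y²(x+y))`.  (Since `Y/X = 3(x-y)`, the exact
correction `d(Y/(3X))` of the s92 dictionary is `d(x-y) = (1 + x²/y²)dx`.) -/
theorem second_kind_dictionary (x y : ℚ) (hy : y ≠ 0) (hxy : x + y ≠ 0) (hne : x ≠ y) :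
    x / y - (-(1 / 4 : ℚ) * (12 / (x + y)) * ((-12) * (1 - x ^ 2 / y ^ 2) / (x + y) ^ 2)
        / (36 * (x - y) / (x + y)) + (1 + x ^ 2 / y ^ 2)) =
      -(x ^ 3 + y ^ 3 - 1) / (y ^ 2 * (x + y)) := by
  have hmn : x - y ≠ 0 := sub_ne_zero.mpr hne
  field_simp
  ring

/-- `Y/X = 3(x - y)`. -/
theorem Y_over_X (x y : ℚ) (hxy : x + y ≠ 0) :
    (36 * (x - y) / (x + y)) / (12 / (x + y)) = 3 * (x - y) := by
  field_simp
  ring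

/-! ## 4. Transport of the Frobenius constants to the raw residue basis -/

/-- If `φω₁₁ = a·ω₂₂` and `φω₂₂ = b·ω₁₁` (a `ℚ`-linear `φ`), then for `e₂₂₂ := ω₁₁/12` and
`e₄₄₄ := -ω₂₂/36` one has `φe₂₂₂ = (-3a)·e₄₄₄` and `φe₄₄₄ = (-b/3)·e₂₂₂`. -/
theorem frobenius_transport {V : Type*} [AddCommGroup V] [Module ℚ V] (φ : V →ₗ[ℚ] V)
    (ω11 ω22 : V) (a b : ℚ) (h1 : φ ω11 = a • ω22) (h2 : φ ω22 = b • ω11) :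
    φ ((1 / 12 : ℚ) • ω11) = (-3 * a) • ((-1 / 36 : ℚ) • ω22) ∧
    φ ((-1 / 36 : ℚ) • ω22) = (-b / 3) • ((1 / 12 : ℚ) • ω11) := by
  constructor
  · rw [map_smul, h1, smul_smul, smul_smul]
    congr 1
    ring
  · rw [map_smul, h2, smul_smul, smul_smul]
    congr 1
    ring

/-- With Coleman's constants `a = -(5/3)Γ³`, `b = 3Γ⁻³` (as read in s91, Kedlaya-checked in s92):
`c_{2→4} = -3a = 5Γ³`, `c_{4→2} = -b/3 = -Γ⁻³`, and `c_{2→4}c_{4→2} = -5` (`= φ²` on `H¹(C₆/F₅)`). -/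
theorem raw_constants (Γ : ℚ) (hΓ : Γ ≠ 0) :
    -3 * (-(5 / 3 : ℚ) * Γ ^ 3) = 5 * Γ ^ 3 ∧ -(3 * (Γ ^ 3)⁻¹) / 3 = -(Γ ^ 3)⁻¹ ∧
    (5 * Γ ^ 3) * (-(Γ ^ 3)⁻¹) = -5 := by
  refine ⟨by ring, by ring, ?_⟩
  field_simp

/-! ## 5. The assembly: THEOREM C1X and COR NINE -/

/-- THEOREM C1X (assembly step).  Hypotheses: the FJ relation `6c₁/25 = H₃/H₁` with
`H₁ = κ·c_{4→2}/Q₂₂₂`, `H₃ = κ'·c_{2→4}/Q₄₄₄`, cleared of denominators; the alternating sign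
`Q₄₄₄ = -Q₂₂₂`; COR STAR `κ' = 6κ`; and `c_{2→4}c_{4→2} = -5`.  Conclusion: `c₁ = 5c_{2→4}²`. -/
theorem c1_from_FJ_and_STAR (c1 c24 c42 κ κ' Q2 Q4 : ℚ) (hκ : κ ≠ 0) (hQ2 : Q2 ≠ 0)
    (h42 : c42 ≠ 0) (hFJ : 6 * c1 * (κ * c42 * Q4) = 25 * (κ' * c24 * Q2)) (hQ : Q4 = -Q2)
    (hSTAR : κ' = 6 * κ) (hφ : c24 * c42 = -5) : c1 = 5 * c24 ^ 2 := by
  subst hQ hSTAR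
  have key : (c1 - 5 * c24 ^ 2) * (6 * κ * Q2 * c42) = 0 := by
    linear_combination (-1 : ℚ) * hFJ - (30 * κ * Q2 * c24) * hφ
  have hne : 6 * κ * Q2 * c42 ≠ 0 :=
    mul_ne_zero (mul_ne_zero (mul_ne_zero (by norm_num) hκ) hQ2) h42
  have := (mul_eq_zero.mp key).resolve_right hne
  exact sub_eq_zero.mp this

/-- The value: `c₁ = 5·(5Γ³)² = 125Γ⁶` (s89's constant, sign included), equivalently
`c₁ = -25·c_{2→4}/c_{4→2}`; and `c₃ = 625/c₁ = 5Γ⁻⁶` (`= 5Γ₅(2/3)⁶`). -/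
theorem c1_value (Γ : ℚ) (hΓ : Γ ≠ 0) :
    5 * (5 * Γ ^ 3) ^ 2 = 125 * Γ ^ 6 ∧ -25 * (5 * Γ ^ 3) / (-(Γ ^ 3)⁻¹) = 125 * Γ ^ 6 ∧
    625 / (125 * Γ ^ 6) = 5 * (Γ ^ 6)⁻¹ := by
  refine ⟨by ring, ?_, ?_⟩
  · field_simp
    ring
  · field_simp
    ring

/-- COR NINE: in the mixed normalisation (`ω_{6,2,2} = 6e₂₂₂`, `ω_{6,4,4} = -18e₄₄₄` on the curve;
`e₁ = -R₁`, `e₃ = -6R₃` on the fourfold) `κ^{Col} = -6²κ`, `κ'^{Col} = -((-18)²/6)κ'`, and with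
`κ' = 6κ` the ratio is exactly `9`: `κ'^{Col} = 9κ^{Col}`. -/
theorem cor_nine (κ : ℚ) : -((-18 : ℚ) ^ 2 / 6) * (6 * κ) = 9 * (-(6 : ℚ) ^ 2 * κ) := by
  ring

/-! ## 6. LEMMA CG leading terms and the closing arithmetic -/

/-- LEMMA CG, leading-term arithmetic at a point at infinity of `C_m`: with `∫e_a = w^{a₂}/(m a₂)·v₀^{a₁-m}`
and `e_ā = -(a₂/m²)v₀^{-a₁}w^{-a₂-1}dw`, the residue is `-(a₂/m²)(1/(m a₂))·v₀^{-m} = 1/m³` because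
`v₀^m = -1`; `m` points give `1/m²`.  Here `vm` stands for `v₀^m`. -/
theorem residue_pairing_leading_terms (m a2 vm : ℚ) (hm : m ≠ 0) (ha : a2 ≠ 0) (hv : vm = -1) :
    m * (-(a2 / m ^ 2) * (1 / (m * a2)) * vm⁻¹) = 1 / m ^ 2 := by
  subst hv
  field_simp

/-- The closing arithmetic of the note: `λ = 3/12 = 1/4`, `μ = (-1/36)(-1/4) = 1/144`, `λ/μ = 36`;
pairing consistency `λμ·deg π·⟨dX/Y,XdX/Y⟩ = (1/4)(1/144)·4·4 = 1/36 = 6·(1/216)`;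
`B(1,1) = 0!0!/1! = 1`, `B(2,2) = 1!1!/3! = 1/6`, ratio `6`; the transported constants
`(1/12)(-5/3)(-36) = 5`, `(-1/36)·3·12 = -1`; `⟨dX/Y, XdX/Y⟩ = (-2)(-2) = 4`;
the literature shape `(-1)^{l+1}5^{4-l}` gives `125` at `l = 1` and `5` at `l = 3`. -/
theorem closing_arithmetic :
    (1 / 12 : ℚ) * 3 = 1 / 4 ∧ (-1 / 36 : ℚ) * (-1 / 4) = 1 / 144 ∧ (1 / 4 : ℚ) / (1 / 144) = 36 ∧
    (1 / 4 : ℚ) * (1 / 144) * 4 * 4 = 1 / 36 ∧ (6 : ℚ) * (1 / 216) = 1 / 36 ∧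
    ((Nat.factorial 0 * Nat.factorial 0 : ℕ) : ℚ) / (Nat.factorial 1 : ℕ) = 1 ∧
    ((Nat.factorial 1 * Nat.factorial 1 : ℕ) : ℚ) / (Nat.factorial 3 : ℕ) = 1 / 6 ∧
    (1 : ℚ) / (1 / 6) = 6 ∧
    (1 / 12 : ℚ) * (-5 / 3) * (-36) = 5 ∧ (-1 / 36 : ℚ) * 3 * 12 = -1 ∧ ((-2 : ℚ) * (-2) = 4) ∧
    ((-1 : ℤ) ^ (1 + 1) * 5 ^ (4 - 1) = 125 ∧ (-1 : ℤ) ^ (3 + 1) * 5 ^ (4 - 3) = 5) := by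
  norm_num [Nat.factorial]

end Summit.HodgeConjecture.HodgeConjecture.Theorems.C1CrossCheck
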